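import Literature.MathematicalPhysics.QuantumFieldTheory.Balaban1983to89.B9Eq315FlatDictionary
import Literature.MathematicalPhysics.QuantumFieldTheory.Balaban1983to89.B9Eq319QprimeLipschitz
import Literature.MathematicalPhysics.QuantumFieldTheory.Balaban1983to89.B5Value126

/-!
# `Balaban1983to89.B9Eq321FlatProjectionDictionary` — T. Bałaban, *Propagators for lattice gauge theories in a background field*, Commun. Math. Phys.
# **99** (1985) 389–434 [Balaban1985BackgroundPropagators] (3.21) p. 394 *«R = R(U) is an orthogonal projection in the Hilbert space L²(Ω₀, g) onto the
# subspace ℛ = Δ^η_U N(Q′), N(Q′) = {λ : Q′λ = 0}»* at `U = 1`, against [Balaban1984PropagatorsI] (1.26)/(1.28) p. 22 *«I − Δ⁻¹Q′*_k(Q′_kΔ⁻²Q′*_k)⁻¹Q′_kΔ⁻¹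
# is a projection»*: ON MEAN-ZERO GAUGE PARAMETERS THE pub-balaban NE9 CHAIN'S FLAT `R(1) = projR Δ^η_1 Q′(1)` IS b05's `1 − PcT` UNDER THE SITE DICTIONARY

statement-level skeleton of published theorems with citation tags; proofs where landed; nothing here is a claim about the Yang–Mills mass gap

PDF held: `paper:balaban1985-cmp99-background-propagators` pp. 393–395 (p0006/p0007 opened by this seat 2026-08-22); [Balaban1984PropagatorsI] p. 22 via the
tree's `B5Value126` docstrings.

WHY THIS FILE (cell context).  Item (B2) of the NE9 leaf-03 OFFER O-ne9leaf03-g58-1 (the flat coercivity `γ₀` of the chain by a carrier bridge to b05's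
uniform [B5] (1.90) `B5DeltaA169.smul_LapOne_le_DeltaA`): after the site/averaging/derivative dictionary `B9Eq315FlatDictionary` (B1), the one letter of the flat
principal operator `D*D + D R(1) D* + aQ(1)†Q(1)` that is not a plain formula is the orthogonal projection `R(1)`.  b05's `Δ_a` carries `1 − PcT` (the
explicit (1.26)); the chain carries `projR` (Mathlib's `starProjection` onto `Δ^η_1 N(Q′(1))`).  The two AGREE on mean-zero site functions — the only inputs
`R` ever receives inside `D R D*` (a lattice divergence has mean zero) —; on constants they differ (`PcT 𝟙 = 0`, `projR 𝟙 = 0`), which is why the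
statement is on `𝟙^⊥`.

WHAT IS PROVED (sorry-free; no inequality of the papers; 0 `def`).  Scalar (`ℂ`-valued) gauge parameters, `φ = LinearEquiv.refl ℂ ℂ`.
* §1 transport along the cast `x ↦ (x_i mod P_i)_i`: `sum_torCast` (sums; the block sum ↔ box sum identity and the chart point's block are
  the tree's `B5Eq155FlatAveragingCommute.sum_blockOf_eq_sum_boxVec` ∕ `perSite_cornerSite_add_boxVec_mem`), **`QprimeW_one_pullback`** (`Q′(1)` of a pulled-back function is `QsOp` of it), **`covLaplace_one_pullback`** (`Δ^η_1` of a
  pulled-back function is `LapS (fine L m) η⁻¹` of it), `inner_pullback` (the weighted inner product (3.11) of two pull-backs is `c₀` times b05's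
  `star u ⬝ᵥ v`).
* §2 **`RofU_one_pullback_eq_one_sub_PcT`**: for every `g : Tor (fine L m) → ℂ` with `Σ g = 0`,
  `R(1)(g ∘ cast) = ((1 − PcT L m η⁻¹) *ᵥ g) ∘ cast` in `SiteL2K ℂ d (L·m) c₀ ℂ` — by Mathlib's characterisation of the orthogonal projection
  (`Submodule.eq_starProjection_of_mem_of_inner_eq_zero`): `(1 − PcT)g = Δλ₀` with `Q′λ₀ = 0` (`B5Value126.LapS_lambda0`, `QsOp_lambda0`) and
  `PcT g = Δ⁻¹Q′*ω₀ ⊥ Δ N(Q′)` (`LapSinv` Hermitian, `LapSinv_LapS_of_orth`, `Q′λ = 0`).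
MODEL / DECLARED READINGS.  (M1) one averaging step, flat background, scalar fields, constant weight `c₀`; (M2) none displayed; (M3) NOT HERE: the
sandwiched operator `D R D*` as a whole, the curl part, the `W`-valued Parseval reduction, the transfer of (1.90).
HONEST SCOPE.  [folklore] identification of two typed orthogonal projections with the same printed meaning; NOT [B9] Thm 3.11, NOT (1.90); NOT summit
progress (cell pub-balaban: NE9 NOT PRINTED / NOT PROVED; «NE9 ⇐ the named binders»; spine PROVED 0/9; HONEST DEPENDENCY: continuum YM on T⁴ ⇐ BetaPertH ∧
nine spine estimates (0/9 proved); BetaPertH ⇐ (D1) ∧ (D4) ∧ CAP+tail; G-an2-4 gates asym, D1 and NE2/3/4).  Unit `b2b-balaban-t4-ne9-formalise-leaf-03`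
(gen 58); NEW file; modifies nothing.  Net new unproved facts: 0.
-/

noncomputable section

open scoped BigOperators InnerProductSpace ComplexConjugate Matrix

namespace Literature.MathematicalPhysics.QuantumFieldTheory.Balaban1983to89.B9Eq321FlatProjectionDictionary

open B4Sect5Torus (TSite)
open B9SectCLatticeCarrier (Bond)
open B7Prop1Explicit (boxVec)
open B9Eq319QprimeTorus (fineP)
open B9Eq311L2Pairing (WL2)
open B11Eq103H1Complex (SiteL2K covDerivL2K covDivL2K covLaplaceSiteK equiv_covDerivL2K equiv_covDivL2K)
open B9Eq310HessianOperator (adTransportW)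
open B9Eq326OperatorAssembly (QprimeW RofU)
open B9Eq315QTorus (perSite cornerSite)
open B9Eq315QFlatNorm (chart_injective cornerSite_add_boxVec_apply cornerSite_add_boxVec_lt)
open B9Eq315FlatDictionary (torCast_bijective torCast_blockPoint QsOp_mulVec_eq_blockMean LapS_mulVec_eq_covLaplace_flat)
open B5Eq172FlatCoercivity (card_blockOf)
open B5Eq172HodgePositivity (adTransportW_one adTransportW_inv_one)
open B5Prop11Plancherel (Tor fine)
open B5Block118 (QsOp bpt)
open B5Action121 (LapS)

variable {d : ℕ} (L : ℕ) [NeZero L] (m : Fin d → ℕ) [∀ i, NeZero (m i)] [∀ i, NeZero (fineP L m i)]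

/-! ## §1 Transport along the cast -/

section Transport

omit [NeZero L] [∀ i, NeZero (m i)] in
/-- A sum over b05's torus `Tor P` ((1.18)'s `T_η` as `Π_i ZMod (P i)`) is the sum over the chain's lattice `TSite d P` ((3.1)'s torus as
`Π_i Fin (P i)`) of the pull-back — the cast is a bijection (`B9Eq315FlatDictionary.torCast_bijective`). [folklore]
[cite: Balaban1984PropagatorsI, (1.18) p.20; Balaban1985BackgroundPropagators, (3.1) p.390] -/
theorem sum_torCast {β : Type*} [AddCommMonoid β] (P : Fin d → ℕ) [∀ i, NeZero (P i)] (g : Tor P → β) :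
    ∑ x : TSite d P, g (fun i => ((x i : ℕ) : ZMod (P i))) = ∑ z, g z :=
  Fintype.sum_bijective _ (torCast_bijective P) _ _ fun _ => rfl

-- (the chart-point membership `(L·y + r) mod L·m ∈ B(y)` is the tree's `B5Eq155FlatAveragingCommute.perSite_cornerSite_add_boxVec_mem` —
-- used below by name; a local copy was refused by the gate's `dedup.landed`, p318961)

-- (the block-sum/box-sum identity is the tree's `B5Eq155FlatAveragingCommute.sum_blockOf_eq_sum_boxVec` — used below by name)

/-! ### The flat letters on pulled-back scalar gauge parameters -/

variable {c₀ : ℝ} [Fact (0 < c₀)]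

omit [Fact (0 < c₀)] in
/-- **`Q′(1)` OF A PULLED-BACK GAUGE PARAMETER IS `QsOp` OF IT**: `(Q′(1)(g ∘ cast))(y) = (QsOp L m *ᵥ g)(y mod m)` — the plain block mean (3.19) at `V = 1`
(`B9Eq319QprimeLipschitz.QprimeW_one_apply`) is (1.20) (`B9Eq315FlatDictionary.QsOp_mulVec_eq_blockMean`) by the block/box sum identity.
[cite: Balaban1985BackgroundPropagators, (3.19) p.393; Balaban1984PropagatorsI, (1.20) p.20] -/
theorem QprimeW_one_pullback (g : Tor (fine L m) → ℂ) (y : TSite d m) :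
    QprimeW L m (LinearEquiv.refl ℂ ℂ) (fun _ : Bond d (fineP L m) => (1 : ℂˣ)) (c₀ := c₀)
        ((WL2.linearEquiv ℂ ℂ (fun _ : TSite d (fineP L m) => c₀)).symm (fun x => g (fun i => ((x i : ℕ) : ZMod (fineP L m i))))) y =
      (QsOp L m).mulVec g (fun i => ((y i : ℕ) : ZMod (m i))) := by
  rw [B9Eq319QprimeLipschitz.QprimeW_one_apply, QsOp_mulVec_eq_blockMean, ← Finset.smul_sum,
    B5Eq155FlatAveragingCommute.sum_blockOf_eq_sum_boxVec,
    Complex.real_smul]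
  congr 1
  push_cast
  rw [one_div]

omit [NeZero L] [∀ i, NeZero (m i)] in
/-- **`Δ^η_1` OF A PULLED-BACK GAUGE PARAMETER IS `LapS (fine L m) η⁻¹` OF IT** (pointwise, through the identification of the `L²` carrier with the
functions). [cite: Balaban1985BackgroundPropagators, (3.23) p.394; Balaban1984PropagatorsI, (1.21) p.21] -/
theorem covLaplace_one_pullback (η : ℝ) (g : Tor (fine L m) → ℂ) (x : TSite d (fineP L m)) :
    WL2.equiv ℂ (fun _ : TSite d (fineP L m) => c₀) ℂ
        (covLaplaceSiteK ((η : ℂ))⁻¹ (adTransportW (LinearEquiv.refl ℂ ℂ) (fun _ : Bond d (fineP L m) => (1 : ℂˣ)))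
          (adTransportW (LinearEquiv.refl ℂ ℂ) fun _ : Bond d (fineP L m) => (1 : ℂˣ)⁻¹)
          ((WL2.linearEquiv ℂ ℂ (fun _ : TSite d (fineP L m) => c₀)).symm (fun x => g (fun i => ((x i : ℕ) : ZMod (fineP L m i)))))) x =
      (LapS (fine L m) ((η : ℂ))⁻¹).mulVec g (fun i => ((x i : ℕ) : ZMod (fineP L m i))) := by
  have hR : (adTransportW (LinearEquiv.refl ℂ ℂ) (fun _ : Bond d (fineP L m) => (1 : ℂˣ))) = fun _ => LinearMap.id :=
    funext fun b => adTransportW_one _ b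
  have hS : (adTransportW (LinearEquiv.refl ℂ ℂ) fun _ : Bond d (fineP L m) => (1 : ℂˣ)⁻¹) = fun _ => LinearMap.id :=
    funext fun b => adTransportW_inv_one _ b
  unfold covLaplaceSiteK
  rw [LinearMap.comp_apply, equiv_covDivL2K, equiv_covDerivL2K, hR, hS,
    LapS_mulVec_eq_covLaplace_flat (fineP L m) _ (B5Eq172HodgePositivity.conj_inv_ofReal η)]
  rfl

omit [NeZero L] [∀ i, NeZero (m i)] in
/-- **THE WEIGHTED INNER PRODUCT (3.11) OF TWO PULLED-BACK SCALAR FUNCTIONS IS `c₀·(star u ⬝ᵥ v)`** on b05's torus. [folklore]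
[cite: Balaban1985BackgroundPropagators, (3.11) p.392] -/
theorem inner_pullback (u v : Tor (fine L m) → ℂ) :
    ⟪(WL2.linearEquiv ℂ ℂ (fun _ : TSite d (fineP L m) => c₀)).symm (fun x => u (fun i => ((x i : ℕ) : ZMod (fineP L m i)))),
      (WL2.linearEquiv ℂ ℂ (fun _ : TSite d (fineP L m) => c₀)).symm (fun x => v (fun i => ((x i : ℕ) : ZMod (fineP L m i))))⟫_ℂ =
      (c₀ : ℂ) * (star u ⬝ᵥ v) := by
  rw [WL2.inner_def, ← Finset.mul_sum, dotProduct, ← sum_torCast (fineP L m) (fun z => star u z * v z)]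
  congr 1
  refine Finset.sum_congr rfl fun x _ => ?_
  rw [WL2.linearEquiv_symm_apply, WL2.linearEquiv_symm_apply, Equiv.apply_symm_apply, Equiv.apply_symm_apply, Pi.star_apply,
    RCLike.star_def, RCLike.inner_apply, mul_comm]

end Transport

/-! ## §2 `R(1) = 1 − PcT` on mean-zero gauge parameters -/

section Projection

variable {c₀ : ℝ} [Fact (0 < c₀)] {η : ℝ} (hη : η ≠ 0)

include hη in
/-- **THE CHAIN's FLAT `R(1)` IS b05's `1 − PcT` ON MEAN-ZERO GAUGE PARAMETERS**: for `g : Tor (fine L m) → ℂ` with `Σ g = 0`,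
`R(1)(g ∘ cast) = ((1 − PcT L m η⁻¹) *ᵥ g) ∘ cast` in the `L²` space of scalar gauge parameters — (3.21)'s orthogonal projection onto `Δ^η_1 N(Q′(1))`
(`B9Eq326OperatorAssembly.RofU … 1` = `projR`, Mathlib's `starProjection`) against (1.26)/(1.28)'s explicit projection: `(1 − PcT)g = Δλ₀`, `Q′λ₀ = 0`
(`B5Value126.LapS_lambda0`, `QsOp_lambda0`) puts it in the subspace, and `PcT g = Δ⁻¹Q′*ω₀ ⊥ Δ N(Q′)` (`LapSinv` Hermitian, `Δ⁻¹Δλ = λ` on `1^⊥`, `Q′λ = 0`)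
gives the orthogonality. [cite: Balaban1985BackgroundPropagators, (3.21)–(3.23) p.394; Balaban1984PropagatorsI, (1.26)–(1.28) p.22, p.25] -/
theorem RofU_one_pullback_eq_one_sub_PcT (g : Tor (fine L m) → ℂ) (hg : ∑ z, g z = 0) :
    RofU L m (LinearEquiv.refl ℂ ℂ) η (fun _ : Bond d (fineP L m) => (1 : ℂˣ)) (c₀ := c₀)
        ((WL2.linearEquiv ℂ ℂ (fun _ : TSite d (fineP L m) => c₀)).symm (fun x => g (fun i => ((x i : ℕ) : ZMod (fineP L m i))))) =
      (WL2.linearEquiv ℂ ℂ (fun _ : TSite d (fineP L m) => c₀)).symm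
        (fun x => ((1 - B5Value126.PcT L m ((η : ℂ))⁻¹).mulVec g) (fun i => ((x i : ℕ) : ZMod (fineP L m i)))) := by
  -- names
  set P := fineP L m with hPdef
  set c : ℂ := ((η : ℂ))⁻¹ with hcdef
  have hc : c ≠ 0 := inv_ne_zero (Complex.ofReal_ne_zero.2 hη)
  set toL2 := (WL2.linearEquiv ℂ ℂ (fun _ : TSite d (fineP L m) => c₀) :
      SiteL2K ℂ d (fineP L m) c₀ ℂ ≃ₗ[ℂ] (TSite d (fineP L m) → ℂ)).symm with htoL2
  set Δs := covLaplaceSiteK (c₀ := c₀) c (adTransportW (LinearEquiv.refl ℂ ℂ) (fun _ : Bond d (fineP L m) => (1 : ℂˣ)))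
    (adTransportW (LinearEquiv.refl ℂ ℂ) fun _ : Bond d (fineP L m) => (1 : ℂˣ)⁻¹) with hΔs
  set Q' := QprimeW L m (LinearEquiv.refl ℂ ℂ) (fun _ : Bond d (fineP L m) => (1 : ℂˣ)) (c₀ := c₀) with hQ'
  set K : Submodule ℂ (SiteL2K ℂ d (fineP L m) c₀ ℂ) := (LinearMap.ker Q').map Δs with hK
  haveI : CompleteSpace K := FiniteDimensional.complete ℂ _
  -- pull-back helpers
  have pull_Δ : ∀ f : Tor (fine L m) → ℂ, Δs (toL2 fun x => f (fun i => ((x i : ℕ) : ZMod (P i)))) =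
      toL2 (fun x => ((LapS (fine L m) c).mulVec f) (fun i => ((x i : ℕ) : ZMod (P i)))) := fun f => by
    apply (WL2.equiv ℂ (fun _ : TSite d (fineP L m) => c₀) ℂ).injective
    funext x
    rw [htoL2, hΔs, covLaplace_one_pullback]
    rfl
  have pull_Q : ∀ f : Tor (fine L m) → ℂ, Q' (toL2 fun x => f (fun i => ((x i : ℕ) : ZMod (P i)))) = 0 ↔ (QsOp L m).mulVec f = 0 := fun f => by
    constructor
    · intro h
      funext z
      obtain ⟨y, rfl⟩ := (torCast_bijective m).2 z
      have hy := congr_fun h y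
      rw [hQ', htoL2, QprimeW_one_pullback] at hy
      exact hy
    · intro h
      funext y
      rw [hQ', htoL2, QprimeW_one_pullback, h]
      rfl
  -- the b05 facts
  have h1P : (1 - B5Value126.PcT L m c).mulVec g = (LapS (fine L m) c).mulVec (B5Value126.lambda0 L m c g) := by
    rw [Matrix.sub_mulVec, Matrix.one_mulVec, B5Value126.LapS_lambda0 L m c hc g hg, B5Value126.PcT_mulVec]
    rfl
  have hQl0 : (QsOp L m).mulVec (B5Value126.lambda0 L m c g) = 0 := B5Value126.QsOp_lambda0 L m c hc g
  -- unfold R(1) to the star projection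
  show B11Eq103H1Complex.projR Δs Q' _ = _
  unfold B11Eq103H1Complex.projR
  rw [ContinuousLinearMap.coe_coe]
  refine Submodule.eq_starProjection_of_mem_of_inner_eq_zero ?_ ?_
  · -- membership: `(1 − PcT)g = Δλ₀`, `Q′λ₀ = 0`
    refine Submodule.mem_map.2 ⟨toL2 fun x => B5Value126.lambda0 L m c g (fun i => ((x i : ℕ) : ZMod (P i))), ?_, ?_⟩
    · exact LinearMap.mem_ker.2 ((pull_Q _).2 hQl0)
    · rw [pull_Δ, ← h1P]
  · -- orthogonality: `⟨PcT g, Δλ⟩ = 0` for `Q′λ = 0`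
    intro w hw
    obtain ⟨l, hl, rfl⟩ := Submodule.mem_map.1 hw
    -- write `l` as a pull-back
    set e := Equiv.ofBijective _ (torCast_bijective (fineP L m)) with he
    set lam : Tor (fine L m) → ℂ := fun z => WL2.equiv ℂ (fun _ : TSite d (fineP L m) => c₀) ℂ l (e.symm z) with hlam
    have hl_eq : l = toL2 (fun x => lam (fun i => ((x i : ℕ) : ZMod (P i)))) := by
      apply (WL2.equiv ℂ (fun _ : TSite d (fineP L m) => c₀) ℂ).injective
      funext x
      rw [htoL2, WL2.linearEquiv_symm_apply, Equiv.apply_symm_apply, hlam]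
      show _ = WL2.equiv ℂ (fun _ => c₀) ℂ l (e.symm (e x))
      rw [Equiv.symm_apply_apply]
    have hQlam : (QsOp L m).mulVec lam = 0 := (pull_Q lam).1 (by rw [← hl_eq]; exact LinearMap.mem_ker.1 hl)
    have hsumlam : ∑ z, lam z = 0 := by
      have h := B5Blocks16.sum_QsOp L m lam
      rw [hQlam] at h
      simp only [Pi.zero_apply, Finset.sum_const_zero] at h
      have hn : (1 / (L : ℂ) ^ d) ≠ 0 := by
        have : (L : ℂ) ≠ 0 := by exact_mod_cast NeZero.ne L
        exact one_div_ne_zero (pow_ne_zero _ this)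
      exact (mul_eq_zero.1 h.symm).resolve_left hn
    -- `u − v = PcT g` pulled back
    have huv : toL2 (fun x => g (fun i => ((x i : ℕ) : ZMod (P i)))) -
        toL2 (fun x => ((1 - B5Value126.PcT L m c).mulVec g) (fun i => ((x i : ℕ) : ZMod (P i)))) =
        toL2 (fun x => ((B5Value126.PcT L m c).mulVec g) (fun i => ((x i : ℕ) : ZMod (P i)))) := by
      rw [← map_sub]
      congr 1
      funext x
      simp only [Pi.sub_apply, Matrix.sub_mulVec, Matrix.one_mulVec, sub_sub_cancel]
    rw [huv, hl_eq, pull_Δ, htoL2, inner_pullback]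
    -- b05: `star (PcT g) ⬝ᵥ (LapS λ) = 0`
    have hb : star ((B5Value126.PcT L m c).mulVec g) ⬝ᵥ ((LapS (fine L m) c).mulVec lam) = 0 := by
      rw [B5Value126.PcT_mulVec, Matrix.star_mulVec, B5LaplaceInverse.LapSinv_conjTranspose, ← Matrix.dotProduct_mulVec,
        B5LaplaceInverse.LapSinv_LapS_of_orth _ hc lam hsumlam, Matrix.star_mulVec, Matrix.conjTranspose_conjTranspose,
        ← Matrix.dotProduct_mulVec, hQlam, dotProduct_zero]
    rw [hb, mul_zero]

end Projection

end Literature.MathematicalPhysics.QuantumFieldTheory.Balaban1983to89.B9Eq321FlatProjectionDictionary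

end
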